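import Summits.ResolutionOfSingularities.ResolutionOfSingularities.Theorems.FrobeniusLadderFRationalResolutionCoarseningEtale
import Mathlib.AlgebraicGeometry.Morphisms.Etale
import HarnessLib

/-!
# Crux `FrobeniusLadder.FRationalResolution` (stmt-ResolutionOfSingularities-15317), line `redirect`,
# stub `stub_diagonalizableQuotientResolution` — item (F2c): REGRADING a chart along an injective homomorphism of grading groups
# `ι : A ↪ A'` (same ring, same point, unit-degree subgroup `ι(B)`, pieces `S'_{ι a} = S_a` and `S'_c = 0` off the image)

The multi-root recipe of MEMO-15317-leafhand2-g22 adjoins a `d`-th root of a homogeneous unit `u` of degree `b` at the point; the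
root-adjunction chart `…RootAdjoinChart` needs `b = d • a` for some degree `a`, which fails in `A` in general (e.g. `A = ℤ/p³ ⊕ ℤ/p`,
`b = (p, 1)`, `d = p`). The cure is to first regrade `S` by the pushout `A' = (A × ℤ/(nd))/⟨(b, −d)⟩ ⊇ A`, in which `b = d • a`.
This file provides the regrading step in the stub's frame (via `…Coarsening.exists_coarsening`, which allows any homomorphism):

* `coarse_eq_of_injective`, `coarse_eq_bot_of_not_mem_range` — the pieces of the grading coarsened along an INJECTIVE `ι`;
* ★★ `exists_regraded_chart` — chart `(A, S, 𝒮, φ)` of the stub's shape, point `v`, prime `𝔔` over `v` with unit-degree subgroup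
  `B`, `ι : A →+ A'` injective (`A'` finite) ⇒ a chart `(A', S, 𝒮', φ')` on the SAME ring with `S_a ≤ S'_{ι a}`, `φ'` étale and
  compatible with the structure maps, a point `v'` with `φ' v' = φ v` under which the SAME prime `𝔔` lies, and unit-degree
  subgroup `ι(B)`.

Honest label: helper toward ONE leaf stub; no stub, crux or summit closed. No definitions, no named facts, no sorry.
[folklore; cite: SGA3, Exp. VIII §4–5]
-/

noncomputable section

-- single-problem summit: the doubled namespace component is forced
set_option linter.dupNamespace false

open CategoryTheory AlgebraicGeometry
open Literature.AlgebraicGeometry.Resolution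

namespace Summit.ResolutionOfSingularities.ResolutionOfSingularities.Theorems.FRationalResolution.RegradeChart

universe u v w w'

section Pieces

variable {k : Type u} [CommRing k] {A : Type w} [AddCommGroup A] {S : Type v}
  [CommRing S] [Algebra k S] (𝒮 : A → Submodule k S)
  {A' : Type w'} [AddCommGroup A'] (ι : A →+ A') (hι : Function.Injective ι)
  (𝒮' : A' → Submodule k S) (h𝒮' : ∀ c, 𝒮' c = ⨆ a ∈ {a : A | ι a = c}, 𝒮 a)

include hι h𝒮' in
/-- Along an injective `ι` the coarsened piece over `ι a` is `S_a`. [folklore] -/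
theorem coarse_eq_of_injective (a : A) : 𝒮' (ι a) = 𝒮 a := by
  refine le_antisymm ?_ ?_
  · rw [h𝒮']
    refine iSup₂_le fun a' ha' => ?_
    rw [hι ha']
  · rw [h𝒮']
    exact le_biSup (fun a => 𝒮 a) (show a ∈ {a' : A | ι a' = ι a} from rfl)

include h𝒮' in
/-- The coarsened piece over a degree outside the image of `ι` is zero. [folklore] -/
theorem coarse_eq_bot_of_not_mem_range {c : A'} (hc : c ∉ Set.range ι) : 𝒮' c = ⊥ := by
  rw [h𝒮', eq_bot_iff]
  exact iSup₂_le fun a ha => absurd ⟨a, ha⟩ hc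

end Pieces

/-- ★★ **Regrading a chart along an injective homomorphism of grading groups.** Chart `(A, S, 𝒮, φ)` of the stub's shape,
point `v`, prime `𝔔` over `v` with unit-degree subgroup `B`, and `ι : A →+ A'` injective with `A'` finite. Then `S` is graded by
`A'` with `S_a ≤ S'_{ι a}` (equality; zero off the image), the degree-zero parts agree, so `(A', S, 𝒮', φ')` is a chart of the same
shape through which the same prime `𝔔` lies over a point `v'` with `φ' v' = φ v`, and its unit-degree subgroup is `ι(B)`.
[folklore; cite: SGA3, Exp. VIII §4–5] -/
theorem exists_regraded_chart (k : Type) [Field k] (X : Scheme.{0}) (g : X ⟶ Spec (.of k))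
    (A : Type) [AddCommGroup A] [DecidableEq A] (S : Type) [CommRing S] [Algebra k S]
    (𝒮 : A → Submodule k S) [GradedAlgebra 𝒮]
    (φ : Spec (.of (𝒮 0)) ⟶ X) [Etale φ]
    (hφg : φ ≫ g = Spec.map (CommRingCat.ofHom (algebraMap k (𝒮 0))))
    (v : Spec (.of (𝒮 0))) (𝔔 : Ideal S) [𝔔.IsPrime] (h𝔔v : 𝔔.comap (algebraMap (𝒮 0) S) = v.asIdeal)
    (B : AddSubgroup A) (hB : ∀ a : A, a ∈ B ↔ ∃ s ∈ 𝒮 a, s ∉ 𝔔)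
    (A' : Type) [AddCommGroup A'] [DecidableEq A'] (ι : A →+ A') (hι : Function.Injective ι) :
    ∃ (𝒮' : A' → Submodule k S) (_ : GradedAlgebra 𝒮'),
      (∀ a, 𝒮 a ≤ 𝒮' (ι a)) ∧ (∀ a, 𝒮' (ι a) = 𝒮 a) ∧
      ∃ (φ' : Spec (.of (𝒮' 0)) ⟶ X), Etale φ' ∧
        φ' ≫ g = Spec.map (CommRingCat.ofHom (algebraMap k (𝒮' 0))) ∧
        ∃ (v' : Spec (.of (𝒮' 0))), 𝔔.comap (algebraMap (𝒮' 0) S) = v'.asIdeal ∧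
          (∀ c : A', (∃ s ∈ 𝒮' c, s ∉ 𝔔) ↔ c ∈ B.map ι) ∧ φ' v' = φ v := by
  classical
  obtain ⟨𝒮', inst𝒮', h𝒮', hle⟩ := Coarsening.exists_coarsening 𝒮 ι
  have heq : ∀ a, 𝒮' (ι a) = 𝒮 a := coarse_eq_of_injective 𝒮 ι hι 𝒮' h𝒮'
  -- the degree-zero parts agree
  have h0 : 𝒮' 0 = 𝒮 0 := by rw [← map_zero ι]; exact heq 0
  have hto : ∀ x : 𝒮 0, (x : S) ∈ 𝒮' 0 := fun x => by rw [h0]; exact x.2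
  have hfrom : ∀ y : 𝒮' 0, (y : S) ∈ 𝒮 0 := fun y => by rw [← h0]; exact y.2
  let e : 𝒮 0 ≃+* 𝒮' 0 :=
    { toFun := fun x => ⟨(x : S), hto x⟩
      invFun := fun y => ⟨(y : S), hfrom y⟩
      left_inv := fun x => Subtype.ext rfl
      right_inv := fun y => Subtype.ext rfl
      map_mul' := fun x y => Subtype.ext rfl
      map_add' := fun x y => Subtype.ext rfl }
  have he : ∀ x : 𝒮 0, ((e x : 𝒮' 0) : S) = (x : S) := fun x => rfl
  haveI : IsIso (CommRingCat.ofHom (R := 𝒮 0) (S := 𝒮' 0) e.toRingHom) := by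
    show IsIso (RingEquiv.toCommRingCatIso (R := 𝒮 0) (S := 𝒮' 0) e).hom
    infer_instance
  let φ' : Spec (.of (𝒮' 0)) ⟶ X := Spec.map (CommRingCat.ofHom (R := 𝒮 0) (S := 𝒮' 0) e.toRingHom) ≫ φ
  haveI hφ'et : Etale φ' := inferInstance
  have hcomp : CommRingCat.ofHom (algebraMap k (𝒮 0)) ≫ CommRingCat.ofHom (R := 𝒮 0) (S := 𝒮' 0) e.toRingHom =
      CommRingCat.ofHom (R := k) (S := 𝒮' 0) (algebraMap k (𝒮' 0)) := by
    refine CommRingCat.hom_ext (RingHom.ext fun c => ?_)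
    apply Subtype.ext
    show ((e (algebraMap k (𝒮 0) c) : 𝒮' 0) : S) = ((algebraMap k (𝒮' 0) c : 𝒮' 0) : S)
    rw [he, SetLike.GradeZero.coe_algebraMap, SetLike.GradeZero.coe_algebraMap]
  have hφ'g : φ' ≫ g = Spec.map (CommRingCat.ofHom (R := k) (S := 𝒮' 0) (algebraMap k (𝒮' 0))) := by
    simp only [φ', Category.assoc, hφg, ← Spec.map_comp, hcomp]
  -- the point under the same prime
  let v' : Spec (.of (𝒮' 0)) := ⟨𝔔.comap (algebraMap (𝒮' 0) S), Ideal.IsPrime.comap _⟩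
  have hφ'v : φ' v' = φ v := by
    show φ (Spec.map (CommRingCat.ofHom (R := 𝒮 0) (S := 𝒮' 0) e.toRingHom) v') = φ v
    congr 1
    apply PrimeSpectrum.ext
    rw [Spec.map_apply, PrimeSpectrum.comap_asIdeal, ← h𝔔v]
    show (𝔔.comap (algebraMap (𝒮' 0) S)).comap e.toRingHom = 𝔔.comap (algebraMap (𝒮 0) S)
    rw [Ideal.comap_comap]
    rfl
  -- unit degrees
  have hunits : ∀ c : A', (∃ s ∈ 𝒮' c, s ∉ 𝔔) ↔ c ∈ B.map ι := by
    intro c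
    rw [AddSubgroup.mem_map]
    constructor
    · rintro ⟨s, hs, hsQ⟩
      by_cases hc : c ∈ Set.range ι
      · obtain ⟨a, rfl⟩ := hc
        rw [heq] at hs
        exact ⟨a, (hB a).2 ⟨s, hs, hsQ⟩, rfl⟩
      · rw [coarse_eq_bot_of_not_mem_range 𝒮 ι 𝒮' h𝒮' hc, Submodule.mem_bot] at hs
        exact absurd (hs ▸ 𝔔.zero_mem) hsQ
    · rintro ⟨a, ha, rfl⟩
      obtain ⟨s, hs, hsQ⟩ := (hB a).1 ha
      exact ⟨s, hle a hs, hsQ⟩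
  exact ⟨𝒮', inst𝒮', hle, heq, φ', hφ'et, hφ'g, v', rfl, hunits, hφ'v⟩

end Summit.ResolutionOfSingularities.ResolutionOfSingularities.Theorems.FRationalResolution.RegradeChart

end
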